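import Mathlib
import HarnessLib
import Summits.HubbardSuperconductivity.HubbardSuperconductivity.Theorems.KLProgrammeKLRegimeTwoVolumeTowerBaseDefs
import Summits.HubbardSuperconductivity.HubbardSuperconductivity.Theorems.KLProgrammeKLRegimeTwoVolumeGluedTruncation

/-!
# Route `KLProgramme` — crux K3, VL child `KLRegimeVolumeLimitV17F2` (stmt-HubbardSuperconductivity-20440), blueprint v5 M5 / W4a (splice step): THE GRID
# BASE DEFECT IN THE CANONICAL KEYED FORM from M4a's explicit keyed form plus the fine covariance frame swap (seat hubbard-kl-k3c4-p1 g13; `--supports` 20440)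

M4a (`…TwoVolumeScaleZeroTopFrame.hubbardGrid_sum_norm_kernel_twoVolume_stepZero_le`) writes the keyed two-volume defect of the grid actions with the
EXPLICIT block test `∀ i j, ⌊x_{ij}/L⌋ = ⌊x_{pj}/L⌋` and the explicit residue string; the base of the spine (`…TowerBase`, hypothesis `hgrid`) reads it through
the canonical block structure `klGridBlockEquiv L b M` (`…TowerBaseDefs`).  This file converts one into the other and splices the fine-side covariance frame
swap (`A′` = the fine grid action at its own covariance frame, `B′` = M4a's fine object at the common covariance frame):

* `keyed_klGridBlockEquiv_eq` — the two keyed readings agree string by string;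
* **`tower_base_grid_keyedDefect_splice`** — `Σ_{X p = w} ‖kernel A′ X − [klGridBlockEquiv-keyed] kernel A‖ ≤ r + D` from the frame swap `Σ ‖kernel A′ − kernel B′‖ ≤ r`
  and M4a's `Σ ‖kernel B′ − [explicitly keyed] kernel A‖ ≤ D`.

Proofs only; no definition.
-/

noncomputable section

namespace Summit.HubbardSuperconductivity.HubbardSuperconductivity.Theorems.TwoVolumeSource

set_option linter.dupNamespace false -- summit = problem name (single-conjunct summit), D-0017

open Finset Literature.MathematicalPhysics.QuantumLattice GrassmannAlgebra Literature.Probability.LatticeModels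
open Summit.HubbardSuperconductivity.HubbardSuperconductivity.Theorems.KLProgrammeLegKernels
open Summit.HubbardSuperconductivity.HubbardSuperconductivity.Theorems.KLRegimeSplit
open Summit.HubbardSuperconductivity.HubbardSuperconductivity.Theorems.EngineV8
open Summit.HubbardSuperconductivity.HubbardSuperconductivity.Theorems.TwoVolumeDefect

/-- **The canonical keyed reading is M4a's explicit keyed reading**, string by string. [folklore] -/
theorem keyed_klGridBlockEquiv_eq {L b M : ℕ} [NeZero L] [NeZero (b * L)] (A : GrassmannAlgebra ℂ (GridLeg (GridPoint L (klGridN M))))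
    {m : ℕ} (p : Fin m) (X : Fin m → GridLeg (GridPoint (b * L) (klGridN M))) :
    (if ∀ i, (klGridBlockEquiv L b M (X i)).1 = (klGridBlockEquiv L b M (X p)).1 then kernel ℂ A m (fun i => (klGridBlockEquiv L b M (X i)).2) else 0) =
      (if ∀ i j, ((X i).1.1.2 j).val / L = ((X p).1.1.2 j).val / L then
        kernel ℂ A m (fun i => ((((X i).1.1.1, fun j => ((((X i).1.1.2 j).val : ℕ) : ZMod L)), (X i).1.2), (X i).2)) else 0) := by
  have he1 := klGridBlockEquiv_val L b M
  have hiff : (∀ i, (klGridBlockEquiv L b M (X i)).1 = (klGridBlockEquiv L b M (X p)).1) ↔ ∀ i j, ((X i).1.1.2 j).val / L = ((X p).1.1.2 j).val / L := by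
    refine ⟨fun h i j => ?_, fun h i => funext fun j => Fin.ext ?_⟩
    · rw [← he1, ← he1, h i]
    · rw [he1, he1]; exact h i j
  have hproj : (fun i => (klGridBlockEquiv L b M (X i)).2) = fun i => ((((X i).1.1.1, fun j => ((((X i).1.1.2 j).val : ℕ) : ZMod L)), (X i).1.2), (X i).2) :=
    funext fun i => klGridBlockEquiv_snd L b M (X i)
  by_cases h : ∀ i j, ((X i).1.1.2 j).val / L = ((X p).1.1.2 j).val / L
  · rw [if_pos (hiff.2 h), if_pos h, hproj]
  · rw [if_neg (fun h' => h (hiff.1 h')), if_neg h]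

/-- **THE GRID BASE DEFECT IN THE CANONICAL KEYED FORM** from the fine covariance frame swap (`≤ r`) and M4a's explicitly keyed bound (`≤ D`). [folklore] -/
theorem tower_base_grid_keyedDefect_splice {L b M : ℕ} [NeZero L] [NeZero (b * L)]
    (A' B' : GrassmannAlgebra ℂ (GridLeg (GridPoint (b * L) (klGridN M)))) (A : GrassmannAlgebra ℂ (GridLeg (GridPoint L (klGridN M))))
    {n : ℕ} (p : Fin (n + 1)) (w : GridLeg (GridPoint (b * L) (klGridN M))) {r D : ℝ}
    (hr : ∑ X ∈ univ.filter (fun X : Fin (n + 1) → GridLeg (GridPoint (b * L) (klGridN M)) => X p = w), ‖kernel ℂ A' (n + 1) X - kernel ℂ B' (n + 1) X‖ ≤ r)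
    (hD : ∑ X ∈ univ.filter (fun X : Fin (n + 1) → GridLeg (GridPoint (b * L) (klGridN M)) => X p = w),
      ‖kernel ℂ B' (n + 1) X -
        (if ∀ i j, ((X i).1.1.2 j).val / L = ((X p).1.1.2 j).val / L then
          kernel ℂ A (n + 1) (fun i => ((((X i).1.1.1, fun j => ((((X i).1.1.2 j).val : ℕ) : ZMod L)), (X i).1.2), (X i).2)) else 0)‖ ≤ D) :
    ∑ X ∈ univ.filter (fun X : Fin (n + 1) → GridLeg (GridPoint (b * L) (klGridN M)) => X p = w),
        ‖kernel ℂ A' (n + 1) X -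
          (if ∀ i, (klGridBlockEquiv L b M (X i)).1 = (klGridBlockEquiv L b M (X p)).1 then
            kernel ℂ A (n + 1) (fun i => (klGridBlockEquiv L b M (X i)).2) else 0)‖ ≤ r + D := by
  classical
  simp only [keyed_klGridBlockEquiv_eq A p]
  refine (sum_le_sum fun X _ => norm_sub_le_norm_sub_add_norm_sub _ (kernel ℂ B' (n + 1) X) _).trans ?_
  rw [sum_add_distrib]
  exact add_le_add hr hD

end Summit.HubbardSuperconductivity.HubbardSuperconductivity.Theorems.TwoVolumeSource

end
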